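import Literature.Barriers.RiemannHypothesis.NymanBeurlingObstructionsProofs
import Literature.Barriers.RiemannHypothesis.NymanBeurlingObstructionsSeriesProofs
import Literature.Barriers.RiemannHypothesis.NymanBeurlingObstructionsBDBLSProofs
import HarnessLib

/-!
# The barrier `NymanBeurlingObstructions` — discharged (assembly of the three proved conjuncts)

Barrier catalogue `Literature/Barriers/RiemannHypothesis/` (D-0021). The catalogued declaration
`Literature.Barriers.RiemannHypothesis.NymanBeurlingObstructions`
(`NymanBeurlingObstructions.lean`) is the conjunction

`BaezDuarte2000_prop4_4 ∧ BaezDuarte2000_prop4_7 ∧ BDBLS2000_uniform`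

of three vendored no-go facts inside the Nyman–Beurling–Báez-Duarte criterion. Each conjunct is
proved in its own sibling file:

* `BaezDuarte2000_prop4_4_holds` — the natural Möbius approximation `S_n = ∑_{k ≤ n} μ(k)ρ(1/(kx))`
  does not converge to `−χ` in `L²(0,∞)` (Báez-Duarte 2000, Prop. 4.4; file
  `NymanBeurlingObstructionsProofs.lean`, Part I);
* `BaezDuarte2000_prop4_7_holds` — no fixed-coefficient series `∑_{k ≥ 2} c_k e_k` converges to
  `−χ` in `L²(0,1)` (Báez-Duarte 2000, Prop. 4.7; file `NymanBeurlingObstructionsSeriesProofs.lean`);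
* `BDBLS2000_uniform_holds` — every combination of `ρ_a`, `1 ≤ a ≤ N`, misses `χ` by
  `≥ C/√(log N)` in `L²(0,∞)` (Báez-Duarte–Balazard–Landreau–Saias 2000, as printed in Báez-Duarte
  2003, §1 (1.3); file `NymanBeurlingObstructionsBDBLSProofs.lean`).

This file only assembles them into `NymanBeurlingObstructions_holds` (so that users of
`(h : NymanBeurlingObstructions)` can be fed an unconditional proof) and records the resulting
unconditional forms of the route-cost corollaries of `NymanBeurlingObstructions.lean`
(`natError_ge_of_uniform`, `NymanBeurlingObstructions.cost`). All proofs are complete; axioms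
`propext`, `Classical.choice`, `Quot.sound` only (the zero `½ + iγ₀` of `ζ` entering Props. 4.4/4.7
and the BDBLS bound is kernel-checked in `Literature/NumberTheory/LFunctions/`).

## References

* [BaezDuarte2000] L. Báez-Duarte, *Arithmetical aspects of Beurling's real variable reformulation
  of the Riemann hypothesis*, arXiv:math/0011254 (2000), §4, pp. 10–12, Props. 4.4, 4.5, 4.7,
  Lemma 4.2 (read).
* [BaezDuarte2003] L. Báez-Duarte, *A strengthening of the Nyman–Beurling criterion for the Riemann
  hypothesis*, Rend. Lincei (9) 14 (2003), 5–11; arXiv:math/0202141, §1 (1.3).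
* [BDBLS2000] L. Báez-Duarte, M. Balazard, B. Landreau, E. Saias, *Notes sur la fonction ζ de
  Riemann, 3*, Adv. Math. 149 (2000), 130–144.
-/

noncomputable section

namespace Literature.Barriers.RiemannHypothesis

/-- **The barrier `NymanBeurlingObstructions`, discharged** (Báez-Duarte 2000, Props. 4.4 and 4.7;
BDBLS 2000 as printed in Báez-Duarte 2003, §1 (1.3)): (a) `‖χ + S_n‖_{L²(0,∞)} ↛ 0` for the natural
Möbius approximation, (b) no fixed-coefficient series `∑_{k ≥ 2} c_k e_k` converges to `−χ` in
`L²(0,1)`, (c) `‖χ − ∑ c_j ρ_{a_j}‖₂ ≥ C/√(log N)` whenever `1 ≤ a_j ≤ N`, `N ≥ 2` — from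
`BaezDuarte2000_prop4_4_holds`, `BaezDuarte2000_prop4_7_holds` and `BDBLS2000_uniform_holds`.
[cite: BaezDuarte2000, Props. 4.4 and 4.7, p. 11] -/
theorem NymanBeurlingObstructions_holds : NymanBeurlingObstructions :=
  NymanBeurlingObstructions_of BaezDuarte2000_prop4_4_holds BaezDuarte2000_prop4_7_holds
    BDBLS2000_uniform_holds

/-- **Unconditional rate bound for the tree's route** (`natError_ge_of_uniform` fed with
`BDBLS2000_uniform_holds`): there is `C > 0` such that every natural approximation
`∑_{k<N} c_k ρ_{k+1}` with `N ≥ 2` terms misses `χ` by at least `C/√(log N)` in `L²(0,∞)` — the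
quantity of `Literature.NumberTheory.LFunctions.baezDuarte_iff` (`natError_eq`).
[cite: BaezDuarte2003, §1 (1.3)] -/
theorem natError_ge_holds :
    ∃ C : ℝ, 0 < C ∧ ∀ (N : ℕ) (c : Fin N → ℝ), 2 ≤ N →
      ENNReal.ofReal (C / Real.sqrt (Real.log N)) ≤ natError N c :=
  natError_ge_of_uniform BDBLS2000_uniform_holds

/-- **Unconditional cost of the route** (`NymanBeurlingObstructions.cost` fed with
`NymanBeurlingObstructions_holds`): there is `C > 0` such that, for every `ε > 0`, a natural
approximation with `N ≥ 2` terms achieving `‖χ − ∑_{k<N} c_k ρ_{k+1}‖₂ < ε` (the `ε`-clause of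
`Literature.NumberTheory.LFunctions.baezDuarte_iff`) needs `N > exp((C/ε)²)`.
[cite: BaezDuarte2003, §1 (1.3)] -/
theorem natError_cost_holds :
    ∃ C : ℝ, 0 < C ∧ ∀ (ε : ℝ), 0 < ε → ∀ (N : ℕ) (c : Fin N → ℝ), 2 ≤ N →
      natError N c < ENNReal.ofReal ε → Real.exp ((C / ε) ^ 2) < N :=
  NymanBeurlingObstructions_holds.cost

end Literature.Barriers.RiemannHypothesis
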